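import Summits.QuantumFields.YangMills.Theorems.BalabanUVNodesN11SupplyChainFirstStepSupplierBorelB
import Summits.QuantumFields.YangMills.Theorems.BalabanUVNodesN11Sect3SupplyChainTermRows

/-!
# DAG node N11 — THE CONTINUITY ROAD TO THE SUPPLIER's ROW LAWS: for CONTINUOUS term families BOTH row laws of N11's two Gaussian roads are free —
# dag-n11-w3's `TermRowsAt` ∕ `SupplierTermRows` (measurability rows, and the 𝐑-bound by compactness of `SU(N)^{bonds}`; the 𝐄- and 𝐁-bounds displayed) AND this seat's
# `SupplierBorel` — so the two roads MERGE on continuous suppliers, and N11's token `SupplyChainAt θ p` at a Gaussian certificate follows from `SupplierObligations` +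
# CONTINUOUS BOUNDED terms (the cheaper operand-rows road: NO `cR`, NO K0 row, NO `PartCompat₁₃`), resp. from continuity WITHOUT bounds by the BorelB road

HEADER — WORK-UNIT METADATA.  Cell `pub-ymgap`, YM-PLAN Track A (HUMAN RULING D-0062 ∕ D-0149 width seats), seat `pub-ymgap-dag-n11-w1` (g3; WIDTH SEAT 1 of 4 on NODE n11
[B14]), route `BalabanUVNodes` rev 25 (v1.7 `CoPH` key), item K1⁷ `StabilityBAtRecordR13SepCoPH` = stmt-QuantumFields-20542 (helper lane, `--kind proof --supports 20542 --as
helper`, count-neutral).  Self-located CLAIM-2 of g3 (pub-ymgap INBOX 2026-08-28T08:40Z).  [III] = [Balaban1988Convergent], [I] = [Balaban1987RG1], [IV] = [Balaban1989LargeFieldI].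
Over this seat's `…N11Sect3SupplyChainBorelB` (p596175: `SupplierBorel`), `…BorelBObligationsOfSolvable` (p607459 §3) and `…SupplyChainFirstStepSupplierBorelB` (p617528:
`supplierBorel_firstStepSupplier_iff`), dag-n11-w3's `…N11Sect3SupplyChainTermRows` (p599012: `TermRowsAt`, `SupplierTermRows`, `operandRowsAlongChain_of_supplierTermRows`,
`sLaw₁₃CoPH_all_of_obligations_of_gaussCert_of_supplierTermRows`), dag-n11-e's `…Sect3SupplyChainDefs ∕ …ObligationsDefs` (`Sect3Supplier`, `chainWitness`, `SupplierObligations`,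
`SupplyChainAt`, `noExpansionObligation_of_gaussCert_of_operandRows`), this seat's g0 `…GaussianCertificateDefs` (`gaussPinH`, `provisos₁₃CoPH_gaussPinH`), dag-n08-w2's
`…SupplyChainFirstLink` (`firstStepSupplier`), and — for the configuration space `SU(N)^{bonds}` — Mathlib's `Continuous.measurable` ∕ `IsCompact.bddAbove_image` with the tree's
instances on `SU(N)` (`QuantumLattice.GaugeGroups`: compact, second countable, Borel) transported LOCALLY to `GaugeField` (dag-n07-e's `isCompact_of_isClosed_cfg` pattern, p487790).

WHY THIS FILE.  N11's one-token residual `SupplyChainAt θ p` has, at any `θ` of the Gaussian-certificate class, TWO roads in the tree, each reading ONE law on the supplier's named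
terms besides [III] §3's `SupplierObligations`: (a) dag-n11-e ∕ dag-n11-w3's OPERAND-ROWS road reads `SupplierTermRows θ p σ` — per response and level `1 ≤ j`, measurability of
`U ↦ Re 𝐄^{(j)}`, `U ↦ Re 𝐑^{(j)}`, `(U, A) ↦ Re 𝐁^{(j)}` and ONE uniform bound for each (`TermRowsAt`) — and nothing else (core provisos, `1 ≤ M`); (b) this seat's BorelB road
reads `SupplierBorel θ p σ` — joint Borel-ness of the ℂ-VALUED `𝐁^{(j)}` in `(U, A)` at every level — plus `2 ≤ cR`, K0's rows, the window and `PartCompat₁₃` (p607459 §3).  Neither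
law implies the other (`TermRowsAt`'s 𝐁-row is `.re`-only and carries bounds; this seat's g0∕g2 LOCATED «a ℂ-valued 𝐁-row word would merge the two roads»).  The terms [III] §3
actually constructs are finite sums of traces of products of bond variables, background fields and fluctuation fields — CONTINUOUS in `(U, A)`.  THIS FILE records that on
continuous term families both laws are free: (§1) on the configuration space `GaugeField (F.P K) 0 (SU N) = SU(N)^{bonds}` (compact, second countable, Borel — instances
transported locally from the Pi type, none declared) a continuous function is measurable, so is its real part, the same on `GaugeField × MSFluct`, and a continuous real function
is BOUNDED, uniformly over any finite index (`𝐃_j` is a `Fintype`); (§2) hence `TermRowsAt θ p t₀ j` follows from continuity of `𝐄 ∕ 𝐑 ∕ 𝐁` in the configuration (and the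
fluctuation) with the 𝐑-bound DERIVED and only the 𝐄-bound (uniform over the coupling `g′ ∈ ℝ` — not compact) and the 𝐁-bound (uniform over `A` — not compact) displayed, and
`SupplierTermRows` from the same along the chain; (§3) `SupplierBorel` follows from joint continuity of the ℂ-valued `𝐁` ALONE (no bound), for any supplier and for dag-n08-w2's
first-step supplier; so for continuous bounded terms the two laws hold TOGETHER (`supplierTermRows_and_supplierBorel_of_continuous`); (§4) consequently N11's token and THEOREM 1
of [III] (all levels) at any Gaussian-class `θ` follow from `SupplierObligations` + continuous bounded terms by road (a) — NO `cR`, NO K0 row, NO `PartCompat₁₃` — also at the named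
certificate `gaussPinH θ`; and from `SupplierObligations` + continuity of `𝐁` WITHOUT any bound by road (b), at road (b)'s price (the trade made explicit: the two bounds buy off
`2 ≤ cR`, K0's solvability rows and the run guard).

WHAT THIS FILE PROVES (15 theorems, 0 `def`, 0 `sorry`, 0 `instance`; standard axioms).
§1 `measurable_of_continuous_cfg` · `measurable_re_of_continuous_cfg` · `measurable_of_continuous_cfgFluct` · `measurable_re_of_continuous_cfgFluct` · ★ `exists_abs_le_of_continuous_cfg`
   · `exists_abs_le_of_continuous_cfg_fintype`.
§2 ★★ `termRowsAt_of_continuous` · `supplierTermRows_of_continuous`.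
§3 ★ `supplierBorel_of_continuous` · `supplierBorel_firstStepSupplier_of_continuous` · ★★ `supplierTermRows_and_supplierBorel_of_continuous`.
§4 ★★★ `supplyChainAt_of_gaussCert_of_continuous` · `sLaw₁₃CoPH_all_of_obligations_of_gaussCert_of_continuous` · `supplyChainAt_gaussPinH_of_continuous` · (road (b))
   `supplyChainAt_of_gaussCert_of_continuousB_of_solvable`.

HONEST FRAMING.  Helper lane of K1⁷, count-neutral: point-set topology ∕ measure bookkeeping on the tree's own configuration space + compositions BY NAME of landed theorems.
Continuity of a supplier's terms, the two displayed bounds, `SupplierObligations` ([III] §3 ∕ Thm 2 — (S-α)∕(S-β), XL, nobody's theorem yet; the objects are definers' ∕ the chart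
seat's first) and every key ∕ row are HYPOTHESES, inhabited at no `θ` here beyond the trivial suppliers; nothing of Bałaban's analysis is asserted or proved.  N11 NOT discharged; K1⁷
NOT closed, no registered stub touched; counts unmoved (typed 28∕28 · discharged 5∕27).  One finite `𝕋⁴_{L^K}` programme at fixed `ε = L^{−K}`; R4 closes only the conditional
finite-𝕋⁴ rung `BalabanLadder.UV` — NOT ℝ⁴, NOT OS, NOT a mass gap, NOT Clay.  No `sorry`, no `axiom`, no `def`, no `instance`, no `notation`.
Sources (SHAPE only): [III] Thm 1 p.262, Theorem p.245, §3 p.279, (2.23)–(2.27) pp.258–259, (2.30)–(2.31) p.260, (2.40)–(2.41) p.261, (3.16)–(3.21) pp.268–269, (3.23)–(3.25) p.270;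
[I] Thm 1 p.258, p.257 (𝐃_j); [IV] (0.2)–(0.4) p.176.
-/

noncomputable section

open MeasureTheory TopologicalSpace
open scoped BigOperators ENNReal NNReal Matrix.Norms.L2Operator

namespace Summit.QuantumFields.YangMills.Theorems.BalabanUVNodesN11SupplierRowsOfContinuous

open Literature.MathematicalPhysics.QuantumFieldTheory.Balaban1983to89 T4Continuum T4NestedCovariance Node00 Node00.Tk DagBinding
open B15DeterminingSets B8Eq17ClassAkV1 B14.Eq218Concrete B10Eq42TorusConstraint Step
open B14.Eq213MaximalDomains (side)
open B14.Eq213DetSet (Bj)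
open Literature.MathematicalPhysics.QuantumFieldTheory.BalabanImbrieJaffe1984to88.BIJ85Eq453GaugeField (qsstarGIter0)
open BalabanUVNodesN11HistoryPinnedResidualDefs BalabanUVNodesN11RePinnedParamDefs
open BalabanUVNodesN11FluctTruncationDefs (IsFluctLocal)
open BalabanUVNodesN11GaussianCertificateDefs (gaussPinH gaussPinH_ζ0 gaussPinH_quad provisos₁₃CoPH_gaussPinH)
open BalabanUVNodesN11Sect3SupplyChainDefs
open BalabanUVNodesN11Sect3SupplyChainBorelB
open BalabanUVNodesN11Sect3SupplyChainObligationsDefs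
open BalabanUVNodesN11Sect3SupplyChainBorelBObligationsOfSolvable
open BalabanUVNodesN11Sect3SupplyChainTermRows (TermRowsAt SupplierTermRows operandRowsAlongChain_of_supplierTermRows sLaw₁₃CoPH_all_of_obligations_of_gaussCert_of_supplierTermRows)
open BalabanUVNodesN11SupplyChainFirstLink (firstStepSupplier)
open BalabanUVNodesN11SupplyChainFirstStepSupplierBorelB (supplierBorel_firstStepSupplier_iff)

variable {F : T4Family} {N : ℕ} [NeZero N]

/-! ## §1  The configuration space `SU(N)^{bonds}`: continuous ⇒ measurable, continuous real ⇒ bounded (instances transported locally; none declared) -/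

section Cfg

variable {K : ℕ} {α : Type*} [TopologicalSpace α] [MeasurableSpace α] [BorelSpace α]

omit [NeZero N] in
/-- **A continuous function of the fine configuration is measurable**: `GaugeField (F.P K) 0 (SU N) = (PBond → SU N)` carries the product topology and the product σ-algebra of
`SU(N)` (compact, second countable, Borel — tree `QuantumLattice.GaugeGroups`), so its opens are measurable (`Pi.opensMeasurableSpace`, transported by `inferInstanceAs`; no instance
is declared). [cite: Balaban1988Convergent, (2.27) p.259 (bookkeeping: measurability of the terms)] -/
theorem measurable_of_continuous_cfg {f : GaugeField (F.P K) 0 (SU N) → α} (hf : Continuous f) : Measurable f := by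
  haveI : OpensMeasurableSpace (GaugeField (F.P K) 0 (SU N)) := inferInstanceAs (OpensMeasurableSpace (PBond (F.P K) 0 → SU N))
  exact hf.measurable

omit [NeZero N] in
/-- The real part of a continuous `ℂ`-valued function of the configuration is measurable. [cite: Balaban1988Convergent, (2.27) p.259 (bookkeeping)] -/
theorem measurable_re_of_continuous_cfg {f : GaugeField (F.P K) 0 (SU N) → ℂ} (hf : Continuous f) :
    Measurable (fun U => (f U).re) :=
  measurable_of_continuous_cfg (Complex.continuous_re.comp hf)

omit [NeZero N] in
/-- **A jointly continuous function of (configuration, multi-scale fluctuation field) is jointly measurable** (`GaugeField × MSFluct`; the configuration factor is second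
countable, so the product σ-algebra sees the product topology's opens). [cite: Balaban1988Convergent, (2.40)–(2.41) p.261 (bookkeeping: measurability of the boundary terms)] -/
theorem measurable_of_continuous_cfgFluct {f : GaugeField (F.P K) 0 (SU N) × MSFluct (F.P K) (FluctV N) → α} (hf : Continuous f) : Measurable f := by
  haveI : SecondCountableTopology (GaugeField (F.P K) 0 (SU N)) := inferInstanceAs (SecondCountableTopology (PBond (F.P K) 0 → SU N))
  haveI : OpensMeasurableSpace (GaugeField (F.P K) 0 (SU N)) := inferInstanceAs (OpensMeasurableSpace (PBond (F.P K) 0 → SU N))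
  exact hf.measurable

omit [NeZero N] in
/-- The real part of a jointly continuous `ℂ`-valued function of (configuration, fluctuation) is jointly measurable. [cite: Balaban1988Convergent, (2.40)–(2.41) p.261 (bookkeeping)] -/
theorem measurable_re_of_continuous_cfgFluct {f : GaugeField (F.P K) 0 (SU N) × MSFluct (F.P K) (FluctV N) → ℂ} (hf : Continuous f) :
    Measurable (fun q => (f q).re) :=
  measurable_of_continuous_cfgFluct (Complex.continuous_re.comp hf)

omit [NeZero N] in
/-- **★ A continuous real function of the configuration is BOUNDED**: `SU(N)^{bonds}` is compact (finite product of the compact `SU(N)`; `CompactSpace` transported locally).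
[cite: Balaban1988Convergent, (2.31) p.260 (bookkeeping: the uniform bounds of the 𝐑-terms)] -/
theorem exists_abs_le_of_continuous_cfg {f : GaugeField (F.P K) 0 (SU N) → ℝ} (hf : Continuous f) : ∃ C : ℝ, ∀ U, |f U| ≤ C := by
  haveI : CompactSpace (GaugeField (F.P K) 0 (SU N)) := inferInstanceAs (CompactSpace (PBond (F.P K) 0 → SU N))
  obtain ⟨C, hC⟩ := isCompact_univ.bddAbove_image (continuous_abs.comp hf).continuousOn
  exact ⟨C, fun U => hC ⟨U, Set.mem_univ U, rfl⟩⟩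

omit [NeZero N] in
/-- … uniformly over any finite index family (e.g. the localization domains `X ∈ 𝐃_j`, a `Fintype`). [cite: Balaban1987RG1, p.257 (𝐃_j finite; bookkeeping)] -/
theorem exists_abs_le_of_continuous_cfg_fintype {ι : Type*} [Fintype ι] {f : ι → GaugeField (F.P K) 0 (SU N) → ℝ} (hf : ∀ i, Continuous (f i)) :
    ∃ C : ℝ, ∀ i U, |f i U| ≤ C := by
  choose C hC using fun i => exists_abs_le_of_continuous_cfg (hf i)
  refine ⟨∑ i, C i, fun i U => (hC i U).trans ?_⟩
  exact Finset.single_le_sum (fun i' _ => (abs_nonneg _).trans (hC i' U)) (Finset.mem_univ i)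

end Cfg

/-! ## §2  dag-n11-w3's term rows from continuity (𝐑-bound derived; 𝐄- and 𝐁-bounds displayed) -/

section Rows

variable {θ : Stage13HParams F N} {p : B12.RunParams}

/-- **★★ `TermRowsAt θ p t₀ j` FROM CONTINUITY**: if `U ↦ 𝐄^{(j)}(X, ι U, z; g′)` and `U ↦ 𝐑^{(j)}(X, ι U)` are continuous on the configuration space and `(U, A) ↦ 𝐁^{(j)}(X, ι U,
(S′, A))` is jointly continuous, the three measurability rows hold (§1) and the 𝐑-bound is DERIVED (compactness × finiteness of `𝐃_j`); the 𝐄-bound (uniform over the real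
coupling `g′`) and the 𝐁-bound (uniform over the fluctuation `A`) stay displayed — their index sets are not compact. [cite: Balaban1988Convergent, (2.23)–(2.27) pp.258–259, (2.30)–(2.31) p.260, (2.40)–(2.41) p.261, (3.16)–(3.21) pp.268–269 (bookkeeping)] -/
theorem termRowsAt_of_continuous {t₀ : Sect2.TermValues (F.P p.K) (MatA N) (FluctV N) θ.τ9.M} {j : ℕ}
    (hE : ∀ (X : (Sect2.domSys (F.P p.K) θ.τ9.M j).Dom) (z : Site (F.P p.K) j) (g' : ℝ),
      Continuous (fun U : GaugeField (F.P p.K) 0 (SU N) => t₀.E j X z g' (Sect2.ofBackgroundC (settingOfRecord₁₃ F N θ.toStage13Params p).ι U)))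
    (hCE : ∃ CE : ℝ, ∀ (X : (Sect2.domSys (F.P p.K) θ.τ9.M j).Dom) (z : Site (F.P p.K) j) (g' : ℝ) (U : GaugeField (F.P p.K) 0 (SU N)),
      |(t₀.E j X z g' (Sect2.ofBackgroundC (settingOfRecord₁₃ F N θ.toStage13Params p).ι U)).re| ≤ CE)
    (hR : ∀ X : (Sect2.domSys (F.P p.K) θ.τ9.M j).Dom,
      Continuous (fun U : GaugeField (F.P p.K) 0 (SU N) => t₀.R j X (Sect2.ofBackgroundC (settingOfRecord₁₃ F N θ.toStage13Params p).ι U)))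
    (hB : ∀ (S' : ℕ → Set (Site (F.P p.K) 0)) (X : (Sect2.domSys (F.P p.K) θ.τ9.M j).Dom),
      Continuous (fun q : GaugeField (F.P p.K) 0 (SU N) × MSFluct (F.P p.K) (FluctV N) =>
        t₀.B j X (Sect2.ofBackgroundC (settingOfRecord₁₃ F N θ.toStage13Params p).ι q.1) (S', q.2)))
    (hCB : ∃ CB : ℝ, ∀ (X : (Sect2.domSys (F.P p.K) θ.τ9.M j).Dom) (U : GaugeField (F.P p.K) 0 (SU N)) (a : Tk.SFluct (F.P p.K) (FluctV N)),
      |(t₀.B j X (Sect2.ofBackgroundC (settingOfRecord₁₃ F N θ.toStage13Params p).ι U) a).re| ≤ CB) :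
    TermRowsAt θ p t₀ j :=
  ⟨fun X z g' => measurable_re_of_continuous_cfg (hE X z g'), hCE, fun X => measurable_re_of_continuous_cfg (hR X),
    exists_abs_le_of_continuous_cfg_fintype
      (f := fun (X : (Sect2.domSys (F.P p.K) θ.τ9.M j).Dom) (U : GaugeField (F.P p.K) 0 (SU N)) =>
        (t₀.R j X (Sect2.ofBackgroundC (settingOfRecord₁₃ F N θ.toStage13Params p).ι U)).re)
      fun X => Complex.continuous_re.comp (hR X),
    fun S' X => measurable_re_of_continuous_cfgFluct (hB S' X), hCB⟩

variable (θ p)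

/-- **`SupplierTermRows θ p σ` FROM CONTINUITY ALONG THE CHAIN**: every response's terms at the levels `1 ≤ j` continuous as in `termRowsAt_of_continuous`, with the two displayed
bounds. [cite: Balaban1988Convergent, §3 p.279, (3.24)–(3.25) p.270, (2.27) p.259, (2.31) p.260, (2.41) p.261 (bookkeeping)] -/
theorem supplierTermRows_of_continuous (σ : Sect3Supplier θ p)
    (hE : ∀ (k : ℕ) (s : SeqOfRecord F θ.ν θ.τ9.M (gOfRecord₁₃ F N θ.toStage13Params p) p.K (k + 1)) (j : ℕ), 1 ≤ j → ∀ (X : (Sect2.domSys (F.P p.K) θ.τ9.M j).Dom) (z : Site (F.P p.K) j) (g' : ℝ),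
      Continuous (fun U : GaugeField (F.P p.K) 0 (SU N) => ((σ k (chainWitness θ p σ k).1 (chainWitness θ p σ k).2).1 s).E j X z g' (Sect2.ofBackgroundC (settingOfRecord₁₃ F N θ.toStage13Params p).ι U)))
    (hCE : ∀ (k : ℕ) (s : SeqOfRecord F θ.ν θ.τ9.M (gOfRecord₁₃ F N θ.toStage13Params p) p.K (k + 1)) (j : ℕ), 1 ≤ j → ∃ CE : ℝ, ∀ (X : (Sect2.domSys (F.P p.K) θ.τ9.M j).Dom) (z : Site (F.P p.K) j) (g' : ℝ) (U : GaugeField (F.P p.K) 0 (SU N)),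
      |(((σ k (chainWitness θ p σ k).1 (chainWitness θ p σ k).2).1 s).E j X z g' (Sect2.ofBackgroundC (settingOfRecord₁₃ F N θ.toStage13Params p).ι U)).re| ≤ CE)
    (hR : ∀ (k : ℕ) (s : SeqOfRecord F θ.ν θ.τ9.M (gOfRecord₁₃ F N θ.toStage13Params p) p.K (k + 1)) (j : ℕ), 1 ≤ j → ∀ X : (Sect2.domSys (F.P p.K) θ.τ9.M j).Dom,
      Continuous (fun U : GaugeField (F.P p.K) 0 (SU N) => ((σ k (chainWitness θ p σ k).1 (chainWitness θ p σ k).2).1 s).R j X (Sect2.ofBackgroundC (settingOfRecord₁₃ F N θ.toStage13Params p).ι U)))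
    (hB : ∀ (k : ℕ) (s : SeqOfRecord F θ.ν θ.τ9.M (gOfRecord₁₃ F N θ.toStage13Params p) p.K (k + 1)) (S' : ℕ → Set (Site (F.P p.K) 0)) (j : ℕ) (X : (Sect2.domSys (F.P p.K) θ.τ9.M j).Dom),
      Continuous (fun q : GaugeField (F.P p.K) 0 (SU N) × MSFluct (F.P p.K) (FluctV N) => ((σ k (chainWitness θ p σ k).1 (chainWitness θ p σ k).2).1 s).B j X (Sect2.ofBackgroundC (settingOfRecord₁₃ F N θ.toStage13Params p).ι q.1) (S', q.2)))
    (hCB : ∀ (k : ℕ) (s : SeqOfRecord F θ.ν θ.τ9.M (gOfRecord₁₃ F N θ.toStage13Params p) p.K (k + 1)) (j : ℕ), 1 ≤ j → ∃ CB : ℝ, ∀ (X : (Sect2.domSys (F.P p.K) θ.τ9.M j).Dom) (U : GaugeField (F.P p.K) 0 (SU N)) (a : Tk.SFluct (F.P p.K) (FluctV N)),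
      |(((σ k (chainWitness θ p σ k).1 (chainWitness θ p σ k).2).1 s).B j X (Sect2.ofBackgroundC (settingOfRecord₁₃ F N θ.toStage13Params p).ι U) a).re| ≤ CB) :
    SupplierTermRows θ p σ := fun k s j hj =>
  termRowsAt_of_continuous (hE k s j hj) (hCE k s j hj) (hR k s j hj) (fun S' X => hB k s S' j X) (hCB k s j hj)

end Rows

/-! ## §3  This seat's `SupplierBorel` from joint continuity of the ℂ-valued boundary terms — the two laws together -/

section Borel

variable (θ : Stage13HParams F N) (p : B12.RunParams)

/-- **★ `SupplierBorel θ p σ` FROM JOINT CONTINUITY OF THE RESPONSES' ℂ-VALUED 𝐁 IN `(U, A)`** — no bound, no real part. [cite: Balaban1988Convergent, (2.40)–(2.41) p.261, §3 p.279, (3.24)–(3.25) p.270 (bookkeeping)] -/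
theorem supplierBorel_of_continuous (σ : Sect3Supplier θ p)
    (hB : ∀ (k : ℕ) (s₀ : SeqOfRecord F θ.ν θ.τ9.M (gOfRecord₁₃ F N θ.toStage13Params p) p.K (k + 1)) (S' : ℕ → Set (Site (F.P p.K) 0)) (j : ℕ) (X : (Sect2.domSys (F.P p.K) θ.τ9.M j).Dom),
      Continuous (fun q : GaugeField (F.P p.K) 0 (SU N) × MSFluct (F.P p.K) (FluctV N) => ((σ k (chainWitness θ p σ k).1 (chainWitness θ p σ k).2).1 s₀).B j X (Sect2.ofBackgroundC (settingOfRecord₁₃ F N θ.toStage13Params p).ι q.1) (S', q.2))) :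
    SupplierBorel θ p σ := fun k s₀ S' j X => measurable_of_continuous_cfgFluct (hB k s₀ S' j X)

/-- **`SupplierBorel` AT dag-n08-w2's FIRST-STEP SUPPLIER FROM JOINT CONTINUITY OF `u`'s 𝐁** (p617528's `supplierBorel_firstStepSupplier_iff`). [cite: Balaban1988Convergent, (2.40)–(2.41) p.261, §3 p.279 (bookkeeping)] -/
theorem supplierBorel_firstStepSupplier_of_continuous
    (u : SeqOfRecord F θ.ν θ.τ9.M (gOfRecord₁₃ F N θ.toStage13Params p) p.K 1 → Sect2.TermValues (F.P p.K) (MatA N) (FluctV N) θ.τ9.M)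
    (E₁ : SeqOfRecord F θ.ν θ.τ9.M (gOfRecord₁₃ F N θ.toStage13Params p) p.K 1 → ℝ)
    (hu : ∀ (s₀ : SeqOfRecord F θ.ν θ.τ9.M (gOfRecord₁₃ F N θ.toStage13Params p) p.K 1) (S' : ℕ → Set (Site (F.P p.K) 0)) (j : ℕ)
      (X : (Sect2.domSys (F.P p.K) θ.τ9.M j).Dom),
      Continuous (fun q : GaugeField (F.P p.K) 0 (SU N) × MSFluct (F.P p.K) (FluctV N) =>
        (u s₀).B j X (Sect2.ofBackgroundC (settingOfRecord₁₃ F N θ.toStage13Params p).ι q.1) (S', q.2))) :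
    SupplierBorel θ p (firstStepSupplier θ p u E₁) :=
  (supplierBorel_firstStepSupplier_iff θ p u E₁).mpr fun s₀ S' j X => measurable_of_continuous_cfgFluct (hu s₀ S' j X)

/-- **★★ THE TWO ROADS' LAWS TOGETHER ON CONTINUOUS BOUNDED TERM FAMILIES**: continuity of `𝐄 ∕ 𝐑` in the configuration and of `𝐁` in (configuration, fluctuation) along the chain,
with the displayed 𝐄- and 𝐁-bounds, gives dag-n11-w3's `SupplierTermRows` AND this seat's `SupplierBorel` at once (the ℂ-valued 𝐁 is continuous, so its real part is measurable
and it is Borel) — the located merge of the two Gaussian roads (g0∕g2: «a ℂ-valued 𝐁-row would merge the two roads»), for the terms [III] §3 actually constructs (finite sums of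
traces of products — continuous). [cite: Balaban1988Convergent, (2.27) p.259, (2.31) p.260, (2.40)–(2.41) p.261, §3 p.279, (3.24)–(3.25) p.270 (bookkeeping)] -/
theorem supplierTermRows_and_supplierBorel_of_continuous (σ : Sect3Supplier θ p)
    (hE : ∀ (k : ℕ) (s : SeqOfRecord F θ.ν θ.τ9.M (gOfRecord₁₃ F N θ.toStage13Params p) p.K (k + 1)) (j : ℕ), 1 ≤ j → ∀ (X : (Sect2.domSys (F.P p.K) θ.τ9.M j).Dom) (z : Site (F.P p.K) j) (g' : ℝ),
      Continuous (fun U : GaugeField (F.P p.K) 0 (SU N) => ((σ k (chainWitness θ p σ k).1 (chainWitness θ p σ k).2).1 s).E j X z g' (Sect2.ofBackgroundC (settingOfRecord₁₃ F N θ.toStage13Params p).ι U)))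
    (hCE : ∀ (k : ℕ) (s : SeqOfRecord F θ.ν θ.τ9.M (gOfRecord₁₃ F N θ.toStage13Params p) p.K (k + 1)) (j : ℕ), 1 ≤ j → ∃ CE : ℝ, ∀ (X : (Sect2.domSys (F.P p.K) θ.τ9.M j).Dom) (z : Site (F.P p.K) j) (g' : ℝ) (U : GaugeField (F.P p.K) 0 (SU N)),
      |(((σ k (chainWitness θ p σ k).1 (chainWitness θ p σ k).2).1 s).E j X z g' (Sect2.ofBackgroundC (settingOfRecord₁₃ F N θ.toStage13Params p).ι U)).re| ≤ CE)
    (hR : ∀ (k : ℕ) (s : SeqOfRecord F θ.ν θ.τ9.M (gOfRecord₁₃ F N θ.toStage13Params p) p.K (k + 1)) (j : ℕ), 1 ≤ j → ∀ X : (Sect2.domSys (F.P p.K) θ.τ9.M j).Dom,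
      Continuous (fun U : GaugeField (F.P p.K) 0 (SU N) => ((σ k (chainWitness θ p σ k).1 (chainWitness θ p σ k).2).1 s).R j X (Sect2.ofBackgroundC (settingOfRecord₁₃ F N θ.toStage13Params p).ι U)))
    (hB : ∀ (k : ℕ) (s : SeqOfRecord F θ.ν θ.τ9.M (gOfRecord₁₃ F N θ.toStage13Params p) p.K (k + 1)) (S' : ℕ → Set (Site (F.P p.K) 0)) (j : ℕ) (X : (Sect2.domSys (F.P p.K) θ.τ9.M j).Dom),
      Continuous (fun q : GaugeField (F.P p.K) 0 (SU N) × MSFluct (F.P p.K) (FluctV N) => ((σ k (chainWitness θ p σ k).1 (chainWitness θ p σ k).2).1 s).B j X (Sect2.ofBackgroundC (settingOfRecord₁₃ F N θ.toStage13Params p).ι q.1) (S', q.2)))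
    (hCB : ∀ (k : ℕ) (s : SeqOfRecord F θ.ν θ.τ9.M (gOfRecord₁₃ F N θ.toStage13Params p) p.K (k + 1)) (j : ℕ), 1 ≤ j → ∃ CB : ℝ, ∀ (X : (Sect2.domSys (F.P p.K) θ.τ9.M j).Dom) (U : GaugeField (F.P p.K) 0 (SU N)) (a : Tk.SFluct (F.P p.K) (FluctV N)),
      |(((σ k (chainWitness θ p σ k).1 (chainWitness θ p σ k).2).1 s).B j X (Sect2.ofBackgroundC (settingOfRecord₁₃ F N θ.toStage13Params p).ι U) a).re| ≤ CB) :
    SupplierTermRows θ p σ ∧ SupplierBorel θ p σ :=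
  ⟨supplierTermRows_of_continuous θ p σ hE hCE hR hB hCB, supplierBorel_of_continuous θ p σ hB⟩

end Borel

/-! ## §4  N11's token and THEOREM 1 at a Gaussian certificate from `SupplierObligations` + continuous (bounded) terms -/

section Token

variable {θ : Stage13HParams F N} {p : B12.RunParams}

/-- **★★★ N11's ONE-TOKEN RESIDUAL `SupplyChainAt θ p` AT ANY `θ` OF THE GAUSSIAN-CERTIFICATE CLASS FROM `SupplierObligations` + CONTINUOUS BOUNDED TERMS — NOTHING ELSE OF THE
NO-EXPANSION LANE** (road (a): dag-n11-w3's `operandRowsAlongChain_of_supplierTermRows` + dag-n11-e's `noExpansionObligation_of_gaussCert_of_operandRows`): certificate (`hζ`, `hq`),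
core provisos, `1 ≤ M`; NO `cR`, NO K0 row, NO window, NO `PartCompat₁₃`. [cite: Balaban1988Convergent, Thm 1 p.262, Theorem p.245, §3 p.279, (3.23)–(3.25) p.270, (3.16)–(3.21) pp.268–269, (2.23) p.258] -/
theorem supplyChainAt_of_gaussCert_of_continuous
    (hζ : ∀ (p : B12.RunParams) (n : ℕ) (Ω Λ : ℕ → Set (Site (F.P p.K) 0)), (θ.Zh p n Ω Λ).ζ0 = (ZhPinOfRecord₁₃ θ.toStage13Params p Ω Λ).ζ0)
    (hq : ∀ (p : B12.RunParams) (n : ℕ) (Ω Λ : ℕ → Set (Site (F.P p.K) 0)) (j : ℕ) (Λ' : Set (Site (F.P p.K) 0)) (ω : MultiCfg (F.P p.K) (SU N) (FluctV N)),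
      (θ.Zh p n Ω Λ).quad j Λ' ω = ∑ b ∈ (Set.toFinite (bondsIn j (Λ'ᶜ ∩ Ω (j + 1)))).toFinset, ‖(ω j).2 b‖ ^ 2)
    (h : θ.Provisos₁₃CoPH F N) (hM : 1 ≤ θ.τ9.M) (σ : Sect3Supplier θ p) (hσ : SupplierObligations θ p σ)
    (hE : ∀ (k : ℕ) (s : SeqOfRecord F θ.ν θ.τ9.M (gOfRecord₁₃ F N θ.toStage13Params p) p.K (k + 1)) (j : ℕ), 1 ≤ j → ∀ (X : (Sect2.domSys (F.P p.K) θ.τ9.M j).Dom) (z : Site (F.P p.K) j) (g' : ℝ),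
      Continuous (fun U : GaugeField (F.P p.K) 0 (SU N) => ((σ k (chainWitness θ p σ k).1 (chainWitness θ p σ k).2).1 s).E j X z g' (Sect2.ofBackgroundC (settingOfRecord₁₃ F N θ.toStage13Params p).ι U)))
    (hCE : ∀ (k : ℕ) (s : SeqOfRecord F θ.ν θ.τ9.M (gOfRecord₁₃ F N θ.toStage13Params p) p.K (k + 1)) (j : ℕ), 1 ≤ j → ∃ CE : ℝ, ∀ (X : (Sect2.domSys (F.P p.K) θ.τ9.M j).Dom) (z : Site (F.P p.K) j) (g' : ℝ) (U : GaugeField (F.P p.K) 0 (SU N)),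
      |(((σ k (chainWitness θ p σ k).1 (chainWitness θ p σ k).2).1 s).E j X z g' (Sect2.ofBackgroundC (settingOfRecord₁₃ F N θ.toStage13Params p).ι U)).re| ≤ CE)
    (hR : ∀ (k : ℕ) (s : SeqOfRecord F θ.ν θ.τ9.M (gOfRecord₁₃ F N θ.toStage13Params p) p.K (k + 1)) (j : ℕ), 1 ≤ j → ∀ X : (Sect2.domSys (F.P p.K) θ.τ9.M j).Dom,
      Continuous (fun U : GaugeField (F.P p.K) 0 (SU N) => ((σ k (chainWitness θ p σ k).1 (chainWitness θ p σ k).2).1 s).R j X (Sect2.ofBackgroundC (settingOfRecord₁₃ F N θ.toStage13Params p).ι U)))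
    (hB : ∀ (k : ℕ) (s : SeqOfRecord F θ.ν θ.τ9.M (gOfRecord₁₃ F N θ.toStage13Params p) p.K (k + 1)) (S' : ℕ → Set (Site (F.P p.K) 0)) (j : ℕ) (X : (Sect2.domSys (F.P p.K) θ.τ9.M j).Dom),
      Continuous (fun q : GaugeField (F.P p.K) 0 (SU N) × MSFluct (F.P p.K) (FluctV N) => ((σ k (chainWitness θ p σ k).1 (chainWitness θ p σ k).2).1 s).B j X (Sect2.ofBackgroundC (settingOfRecord₁₃ F N θ.toStage13Params p).ι q.1) (S', q.2)))
    (hCB : ∀ (k : ℕ) (s : SeqOfRecord F θ.ν θ.τ9.M (gOfRecord₁₃ F N θ.toStage13Params p) p.K (k + 1)) (j : ℕ), 1 ≤ j → ∃ CB : ℝ, ∀ (X : (Sect2.domSys (F.P p.K) θ.τ9.M j).Dom) (U : GaugeField (F.P p.K) 0 (SU N)) (a : Tk.SFluct (F.P p.K) (FluctV N)),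
      |(((σ k (chainWitness θ p σ k).1 (chainWitness θ p σ k).2).1 s).B j X (Sect2.ofBackgroundC (settingOfRecord₁₃ F N θ.toStage13Params p).ι U) a).re| ≤ CB) : SupplyChainAt θ p :=
  ⟨σ, hσ, noExpansionObligation_of_gaussCert_of_operandRows hζ hq h hM σ hσ.loc
    (operandRowsAlongChain_of_supplierTermRows (supplierTermRows_of_continuous θ p σ hE hCE hR hB hCB))⟩

/-- **THEOREM 1 OF [III] — `∀ k ≤ K, SLaw₁₃CoPH θ p k` — AT ANY GAUSSIAN-CLASS `θ` FROM `SupplierObligations` + CONTINUOUS BOUNDED TERMS** on the live-selector line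
(dag-n11-w3's `sLaw₁₃CoPH_all_of_obligations_of_gaussCert_of_supplierTermRows` with the term rows from §2). [cite: Balaban1988Convergent, Thm 1 p.262, Theorem p.245, §3 p.279, (3.23)–(3.25) p.270; Balaban1989LargeFieldI, (0.2)–(0.4) p.176, p.177 (i)–(ii)] -/
theorem sLaw₁₃CoPH_all_of_obligations_of_gaussCert_of_continuous
    (hζ : ∀ (p : B12.RunParams) (n : ℕ) (Ω Λ : ℕ → Set (Site (F.P p.K) 0)), (θ.Zh p n Ω Λ).ζ0 = (ZhPinOfRecord₁₃ θ.toStage13Params p Ω Λ).ζ0)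
    (hq : ∀ (p : B12.RunParams) (n : ℕ) (Ω Λ : ℕ → Set (Site (F.P p.K) 0)) (j : ℕ) (Λ' : Set (Site (F.P p.K) 0)) (ω : MultiCfg (F.P p.K) (SU N) (FluctV N)),
      (θ.Zh p n Ω Λ).quad j Λ' ω = ∑ b ∈ (Set.toFinite (bondsIn j (Λ'ᶜ ∩ Ω (j + 1)))).toFinset, ‖(ω j).2 b‖ ^ 2)
    (h : θ.Provisos₁₃CoPH F N)
    (hsel : θ.ppSel = ppSelLiveOfRecord F N θ.ν θ.τ9 (EOfRecord₁₃ F N θ.toStage13Params) (wOfRecord₉ F N θ.toStage9Params))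
    (hθ : θ.Admissible F N) (hκ : 0 ≤ θ.s2.lf.κ) (hE₀ : 0 ≤ θ.s2.lf.E₀) (hB₀ : 0 ≤ θ.s2.lf.B₀) (hM : 1 ≤ θ.τ9.M) (σ : Sect3Supplier θ p)
    (hσ : SupplierObligations θ p σ)
    (hE : ∀ (k : ℕ) (s : SeqOfRecord F θ.ν θ.τ9.M (gOfRecord₁₃ F N θ.toStage13Params p) p.K (k + 1)) (j : ℕ), 1 ≤ j → ∀ (X : (Sect2.domSys (F.P p.K) θ.τ9.M j).Dom) (z : Site (F.P p.K) j) (g' : ℝ),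
      Continuous (fun U : GaugeField (F.P p.K) 0 (SU N) => ((σ k (chainWitness θ p σ k).1 (chainWitness θ p σ k).2).1 s).E j X z g' (Sect2.ofBackgroundC (settingOfRecord₁₃ F N θ.toStage13Params p).ι U)))
    (hCE : ∀ (k : ℕ) (s : SeqOfRecord F θ.ν θ.τ9.M (gOfRecord₁₃ F N θ.toStage13Params p) p.K (k + 1)) (j : ℕ), 1 ≤ j → ∃ CE : ℝ, ∀ (X : (Sect2.domSys (F.P p.K) θ.τ9.M j).Dom) (z : Site (F.P p.K) j) (g' : ℝ) (U : GaugeField (F.P p.K) 0 (SU N)),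
      |(((σ k (chainWitness θ p σ k).1 (chainWitness θ p σ k).2).1 s).E j X z g' (Sect2.ofBackgroundC (settingOfRecord₁₃ F N θ.toStage13Params p).ι U)).re| ≤ CE)
    (hR : ∀ (k : ℕ) (s : SeqOfRecord F θ.ν θ.τ9.M (gOfRecord₁₃ F N θ.toStage13Params p) p.K (k + 1)) (j : ℕ), 1 ≤ j → ∀ X : (Sect2.domSys (F.P p.K) θ.τ9.M j).Dom,
      Continuous (fun U : GaugeField (F.P p.K) 0 (SU N) => ((σ k (chainWitness θ p σ k).1 (chainWitness θ p σ k).2).1 s).R j X (Sect2.ofBackgroundC (settingOfRecord₁₃ F N θ.toStage13Params p).ι U)))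
    (hB : ∀ (k : ℕ) (s : SeqOfRecord F θ.ν θ.τ9.M (gOfRecord₁₃ F N θ.toStage13Params p) p.K (k + 1)) (S' : ℕ → Set (Site (F.P p.K) 0)) (j : ℕ) (X : (Sect2.domSys (F.P p.K) θ.τ9.M j).Dom),
      Continuous (fun q : GaugeField (F.P p.K) 0 (SU N) × MSFluct (F.P p.K) (FluctV N) => ((σ k (chainWitness θ p σ k).1 (chainWitness θ p σ k).2).1 s).B j X (Sect2.ofBackgroundC (settingOfRecord₁₃ F N θ.toStage13Params p).ι q.1) (S', q.2)))
    (hCB : ∀ (k : ℕ) (s : SeqOfRecord F θ.ν θ.τ9.M (gOfRecord₁₃ F N θ.toStage13Params p) p.K (k + 1)) (j : ℕ), 1 ≤ j → ∃ CB : ℝ, ∀ (X : (Sect2.domSys (F.P p.K) θ.τ9.M j).Dom) (U : GaugeField (F.P p.K) 0 (SU N)) (a : Tk.SFluct (F.P p.K) (FluctV N)),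
      |(((σ k (chainWitness θ p σ k).1 (chainWitness θ p σ k).2).1 s).B j X (Sect2.ofBackgroundC (settingOfRecord₁₃ F N θ.toStage13Params p).ι U) a).re| ≤ CB) : ∀ k, k ≤ p.K → SLaw₁₃CoPH F N θ p k :=
  sLaw₁₃CoPH_all_of_obligations_of_gaussCert_of_supplierTermRows hζ hq h hsel hθ hκ hE₀ hB₀ hM σ hσ (supplierTermRows_of_continuous θ p σ hE hCE hR hB hCB)

/-- **(road (b)) N11's TOKEN AT A GAUSSIAN-CLASS `θ` FROM `SupplierObligations` + CONTINUITY OF THE ℂ-VALUED 𝐁 WITHOUT ANY BOUND — at the BorelB road's price** (p607459 §3 with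
`SupplierBorel` from §3): `2 ≤ cR`, the key, admissibility, `0 < M₁ ≤ M`, the run's window and `PartCompat₁₃`, the five numeric rows, K0's per-cube [15]-solvability and the cube
cover — the TRADE made explicit: the two bounds of road (a) buy off exactly these. [cite: Balaban1988Convergent, Thm 1 p.262, Theorem p.245, §3 p.279, (3.24)–(3.25) p.270, (2.27)–(2.28) p.259, p.257; Balaban1985Variational, Thm 1 (7)–(8) pp.278–279] -/
theorem supplyChainAt_of_gaussCert_of_continuousB_of_solvable
    (hζ : ∀ (p' : B12.RunParams) (n : ℕ) (Ω Λ : ℕ → Set (Site (F.P p'.K) 0)), (θ.Zh p' n Ω Λ).ζ0 = (ZhPinOfRecord₁₃ θ.toStage13Params p' Ω Λ).ζ0)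
    (hq : ∀ (p' : B12.RunParams) (n : ℕ) (Ω Λ : ℕ → Set (Site (F.P p'.K) 0)) (j : ℕ) (Λ' : Set (Site (F.P p'.K) 0)) (ω : MultiCfg (F.P p'.K) (SU N) (FluctV N)),
      (θ.Zh p' n Ω Λ).quad j Λ' ω = ∑ b ∈ (Set.toFinite (bondsIn j (Λ'ᶜ ∩ Ω (j + 1)))).toFinset, ‖(ω j).2 b‖ ^ 2)
    (h : θ.Provisos₁₃SepCoPH F N) (hθ : θ.Admissible F N) (hM₁ : 0 < θ.ν.M₁) (hle : θ.ν.M₁ ≤ θ.τ9.M) (hcR : 2 ≤ θ.s2.cR)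
    (hw : Step.InInterval θ.γ p.K (gOfRecord₁₃ F N θ.toStage13Params p)) (hPC : PartCompat₁₃ F N θ.toStage13Params p p.K)
    (h3 : ∀ j, 1 ≤ j → j ≤ p.K →
      3 * side (F.P p.K).L θ.ν.M₁ j ≤ cubeSide (F.P p.K).L θ.ν.M₂ (RkOfRecord (F.P p.K).L θ.ν.r (gOfRecord₁₃ F N θ.toStage13Params p j)) j)
    (hR : ∀ j, 1 ≤ j → j ≤ p.K → (F.P p.K).L ^ j + (((F.P p.K).d + 4) * (F.P p.K).L + 2) * (∑ l ∈ Finset.range j, (F.P p.K).L ^ l) + 2 ≤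
      cubeSide (F.P p.K).L θ.ν.M₂ (RkOfRecord (F.P p.K).L θ.ν.r (gOfRecord₁₃ F N θ.toStage13Params p j)) j)
    (hε : ∀ j, 1 ≤ j → j ≤ p.K → 0 < epsOfRecord θ.ν (gOfRecord₁₃ F N θ.toStage13Params p) j)
    (hε3 : ∀ j, 1 ≤ j → j ≤ p.K → (143 * (((((F.P p.K).d + 4 : ℕ) : ℝ)) ^ 2 / 4) ^ 2) * epsOfRecord θ.ν (gOfRecord₁₃ F N θ.toStage13Params p) j ≤ 1 / 3)
    (hε2 : ∀ j, 1 ≤ j → j ≤ p.K →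
      2 * epsOfRecord θ.ν (gOfRecord₁₃ F N θ.toStage13Params p) j ≤ 2 * ExpMeanLog.deltaSU (Fin N) / ((((F.P p.K).d + 4) * (F.P p.K).L : ℕ) : ℝ) ^ 2)
    (hsolv : ∀ j, 1 ≤ j → j ≤ p.K → ∀ (s : SeqOfRecord F θ.ν θ.τ9.M (gOfRecord₁₃ F N θ.toStage13Params p) p.K j) (V : GaugeField (F.P p.K) j (SU N)),
      chiSeqOfRecord F N θ.ν θ.τ9.M (gOfRecord₁₃ F N θ.toStage13Params p) p.K j s V ≠ 0 →
      ∀ a ∈ cubesIn (fun a : ↥(cubeIndices (F.P p.K) (cubeSide (F.P p.K).L θ.ν.M₂ (RkOfRecord (F.P p.K).L θ.ν.r (gOfRecord₁₃ F N θ.toStage13Params p j)) j)) =>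
          cubeEnl (F.P p.K) (cubeSide (F.P p.K).L θ.ν.M₂ (RkOfRecord (F.P p.K).L θ.ν.r (gOfRecord₁₃ F N θ.toStage13Params p j)) j) a 0) (s.Ω j),
        ∃ U₀, IsMinimizer (avOfRecord F N p.K) {U | PlaqSmall (θ.ν.εreg * (F.P p.K).eta j ^ 2) U}
          (Bj θ.ν.M₁ (cubeEnl (F.P p.K) (cubeSide (F.P p.K).L θ.ν.M₂ (RkOfRecord (F.P p.K).L θ.ν.r (gOfRecord₁₃ F N θ.toStage13Params p j)) j) a 4) j)
          (avgFamily (avOfRecord F N p.K) (qsstarGIter0 j V)) U₀)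
    (hcov : ∀ j, 1 ≤ j → j ≤ p.K → ∀ s : SeqOfRecord F θ.ν θ.τ9.M (gOfRecord₁₃ F N θ.toStage13Params p) p.K j,
      s.Ω j ⊆ ⋃ a ∈ cubesIn (fun a : ↥(cubeIndices (F.P p.K) (cubeSide (F.P p.K).L θ.ν.M₂ (RkOfRecord (F.P p.K).L θ.ν.r (gOfRecord₁₃ F N θ.toStage13Params p j)) j)) =>
          cubeEnl (F.P p.K) (cubeSide (F.P p.K).L θ.ν.M₂ (RkOfRecord (F.P p.K).L θ.ν.r (gOfRecord₁₃ F N θ.toStage13Params p j)) j) a 0) (s.Ω j),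
        cubeEnl (F.P p.K) (cubeSide (F.P p.K).L θ.ν.M₂ (RkOfRecord (F.P p.K).L θ.ν.r (gOfRecord₁₃ F N θ.toStage13Params p j)) j) a 0)
    (σ : Sect3Supplier θ p) (hσ : SupplierObligations θ p σ)
    (hB : ∀ (k : ℕ) (s₀ : SeqOfRecord F θ.ν θ.τ9.M (gOfRecord₁₃ F N θ.toStage13Params p) p.K (k + 1)) (S' : ℕ → Set (Site (F.P p.K) 0)) (j : ℕ) (X : (Sect2.domSys (F.P p.K) θ.τ9.M j).Dom),
      Continuous (fun q : GaugeField (F.P p.K) 0 (SU N) × MSFluct (F.P p.K) (FluctV N) => ((σ k (chainWitness θ p σ k).1 (chainWitness θ p σ k).2).1 s₀).B j X (Sect2.ofBackgroundC (settingOfRecord₁₃ F N θ.toStage13Params p).ι q.1) (S', q.2))) : SupplyChainAt θ p :=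
  supplyChainAt_of_gaussCert_of_supplierBorel_of_solvable θ p hζ hq h hθ hM₁ hle hcR hw hPC h3 hR hε hε3 hε2 hsolv hcov σ hσ
    (supplierBorel_of_continuous θ p σ hB)

end Token

section Named

variable (θ : Stage13HParams F N) (p : B12.RunParams)

/-- **`SupplyChainAt (gaussPinH θ) p` AT THE NAMED GAUSSIAN CERTIFICATE OF ANY `θ` FROM `SupplierObligations` + CONTINUOUS BOUNDED TERMS AT THE CERTIFICATE** — NO class
hypothesis (`gaussPinH_ζ0 ∕ gaussPinH_quad` are `rfl`; the core provisos transfer by g0's `provisos₁₃CoPH_gaussPinH`); road (a), so NO `cR`, NO K0 row, NO `PartCompat₁₃`.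
[cite: Balaban1988Convergent, Thm 1 p.262, Theorem p.245, §3 p.279, (3.16) p.268, (3.23)–(3.25) p.270] -/
theorem supplyChainAt_gaussPinH_of_continuous (h : θ.Provisos₁₃CoPH F N) (hM : 1 ≤ θ.τ9.M) (σ : Sect3Supplier (gaussPinH θ) p)
    (hσ : SupplierObligations (gaussPinH θ) p σ)
    (hE : ∀ (k : ℕ) (s : SeqOfRecord F (gaussPinH θ).ν (gaussPinH θ).τ9.M (gOfRecord₁₃ F N (gaussPinH θ).toStage13Params p) p.K (k + 1)) (j : ℕ), 1 ≤ j → ∀ (X : (Sect2.domSys (F.P p.K) (gaussPinH θ).τ9.M j).Dom) (z : Site (F.P p.K) j) (g' : ℝ),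
      Continuous (fun U : GaugeField (F.P p.K) 0 (SU N) => ((σ k (chainWitness (gaussPinH θ) p σ k).1 (chainWitness (gaussPinH θ) p σ k).2).1 s).E j X z g' (Sect2.ofBackgroundC (settingOfRecord₁₃ F N (gaussPinH θ).toStage13Params p).ι U)))
    (hCE : ∀ (k : ℕ) (s : SeqOfRecord F (gaussPinH θ).ν (gaussPinH θ).τ9.M (gOfRecord₁₃ F N (gaussPinH θ).toStage13Params p) p.K (k + 1)) (j : ℕ), 1 ≤ j → ∃ CE : ℝ, ∀ (X : (Sect2.domSys (F.P p.K) (gaussPinH θ).τ9.M j).Dom) (z : Site (F.P p.K) j) (g' : ℝ) (U : GaugeField (F.P p.K) 0 (SU N)),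
      |(((σ k (chainWitness (gaussPinH θ) p σ k).1 (chainWitness (gaussPinH θ) p σ k).2).1 s).E j X z g' (Sect2.ofBackgroundC (settingOfRecord₁₃ F N (gaussPinH θ).toStage13Params p).ι U)).re| ≤ CE)
    (hR : ∀ (k : ℕ) (s : SeqOfRecord F (gaussPinH θ).ν (gaussPinH θ).τ9.M (gOfRecord₁₃ F N (gaussPinH θ).toStage13Params p) p.K (k + 1)) (j : ℕ), 1 ≤ j → ∀ X : (Sect2.domSys (F.P p.K) (gaussPinH θ).τ9.M j).Dom,
      Continuous (fun U : GaugeField (F.P p.K) 0 (SU N) => ((σ k (chainWitness (gaussPinH θ) p σ k).1 (chainWitness (gaussPinH θ) p σ k).2).1 s).R j X (Sect2.ofBackgroundC (settingOfRecord₁₃ F N (gaussPinH θ).toStage13Params p).ι U)))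
    (hB : ∀ (k : ℕ) (s : SeqOfRecord F (gaussPinH θ).ν (gaussPinH θ).τ9.M (gOfRecord₁₃ F N (gaussPinH θ).toStage13Params p) p.K (k + 1)) (S' : ℕ → Set (Site (F.P p.K) 0)) (j : ℕ) (X : (Sect2.domSys (F.P p.K) (gaussPinH θ).τ9.M j).Dom),
      Continuous (fun q : GaugeField (F.P p.K) 0 (SU N) × MSFluct (F.P p.K) (FluctV N) => ((σ k (chainWitness (gaussPinH θ) p σ k).1 (chainWitness (gaussPinH θ) p σ k).2).1 s).B j X (Sect2.ofBackgroundC (settingOfRecord₁₃ F N (gaussPinH θ).toStage13Params p).ι q.1) (S', q.2)))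
    (hCB : ∀ (k : ℕ) (s : SeqOfRecord F (gaussPinH θ).ν (gaussPinH θ).τ9.M (gOfRecord₁₃ F N (gaussPinH θ).toStage13Params p) p.K (k + 1)) (j : ℕ), 1 ≤ j → ∃ CB : ℝ, ∀ (X : (Sect2.domSys (F.P p.K) (gaussPinH θ).τ9.M j).Dom) (U : GaugeField (F.P p.K) 0 (SU N)) (a : Tk.SFluct (F.P p.K) (FluctV N)),
      |(((σ k (chainWitness (gaussPinH θ) p σ k).1 (chainWitness (gaussPinH θ) p σ k).2).1 s).B j X (Sect2.ofBackgroundC (settingOfRecord₁₃ F N (gaussPinH θ).toStage13Params p).ι U) a).re| ≤ CB) : SupplyChainAt (gaussPinH θ) p :=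
  supplyChainAt_of_gaussCert_of_continuous (gaussPinH_ζ0 θ) (gaussPinH_quad θ) (provisos₁₃CoPH_gaussPinH h) hM σ hσ hE hCE hR hB hCB

end Named

end Summit.QuantumFields.YangMills.Theorems.BalabanUVNodesN11SupplierRowsOfContinuous

end
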